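import Summits.BirchSwinnertonDyer.Rank1Residual.WAll.AltClosersGlueSlices
import Summits.BirchSwinnertonDyer.Rank1Residual.WAll.TargetX1Slices
import HarnessLib

/-!
# Rung W-ALL (D-0120): the registry with ROW 4 (corner X1) at SLICE granularity — balanced rank-`0`
# (`WAllCornerX1RankZeroBalanced`, the `RealTwistEisenstein` route's retarget), unbalanced rank-`0`,
# rank-`1` — and row 5 / X2c from the typed target `X2.Target` (cell `bsd-wall`, lane 2, seat ty-2)

HONEST FRAMING (cell `bsd-wall`, run/shared/lean/pub/bsd-wall/; WALL-BRIEF-v1 §2). NOTHING ASSERTED: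
no `def`, no `@[conjecture]`, no named fact, no route file imported; W-ALL is OPEN and this file
proves bookkeeping only. In `wAllExclusions_of_sliceLeaves` (`AltClosersGlueSlices.lean`) rows 4, 5
and the X2c part of row 3 enter through ONE hypothesis, the rung-K5 leaf `Eisenstein.EisensteinPrimes`
(`= BSDpOnClassX1 ∧ X2.Target`). After the tribunal's round-1 retarget of route `RealTwistEisenstein`
(director-bsd 2026-08-27T06:22:36Z) row 4 has its own Theses-free slices — `WAll/TargetX1Slices.lean`
(p507296 / p507093): `WAllCornerX1RankZeroBalanced` (the route's new `--closes-target`),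
`WAllCornerX1RankZeroUnbalanced` (= its old residual item 20335 verbatim; rung-K5 crux 19035's
double-twist rider territory), and the rank-`1` leaf statement `X1.RankOne.Statement` (itself =
type-A cell, Keller–Yin Theorem A road, ∧ LEAF I1 `SchneiderWeaken.TypeBRankOneUnridered`:
`x1RankOneStatement_of_typeA_of_typeBLeaf`). This file re-keys the registry accordingly:

* `wallEisenstein_of_x1Slices_of_x2Target` — rows 4 / 5 / X2c ⇐ the three X1 slices + the typed target
  `X2.Target` (`wAllCornerX1_of_x1Slices`, `X2.targets_of_target`, `wallCornerX2_of_x2TargetsAB`,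
  `wallExclX2RankOne_of_x2TargetC`);
* `wAllExclusions_of_sliceLeaves_x1Slices` — the closed list with rows 2 / 7 / 12i by prime × rank
  slices (as in `wAllExclusions_of_sliceLeaves`) AND row 4 by its three slices, row 5 / X2c from
  `X2.Target`; 22 leaf / slice / target / residual hypotheses + `hW`, `hmod`, `hGZK`;
* `wAll_of_sliceLeaves_x1Slices_primaryGZ` (+ FIFTEEN named facts, Gross–Zagier side primary) and
  `wAllFormula_of_sliceLeaves_x1Slices_primaryGZ` (+ the single sign binder `hL0`);
* `wAllExclusions_of_sliceLeaves_x1Cells` — the same with the rank-`1` slice read as type-A cell +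
  LEAF I1.

No census number moves; typed ≠ proved ≠ endorsed; BSD is not proved by any of this.

References: `WAll/TargetX1Slices.lean` (drafted by seat bsd-wall-eis g2); `WAll/AltClosersGlueSlices.lean`
(p505908); `WAll/AltClosersResidualCells.lean` §1 (p498853); `WAll/AltClosersGlue.lean` (X2 glue);
HOME/INBOX 2026-08-27T06:22:36Z (RTE repair order); [cite: Mazur1978, §6 Prop. 6.3 (1) (p. 153)];
[cite: Darmon2004, Thm. 3.22 and §3.9]; [cite: Miller2011LMS, §1 and Def. 1.1].
-/

noncomputable section

open scoped Classical

open WeierstrassCurve Literature.NumberTheory.EllipticCurves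
  Literature.NumberTheory.EllipticCurves.Rank1Residual
  Literature.NumberTheory.EllipticCurves.Rank1Residual.Typed
  Literature.NumberTheory.EllipticCurves.Wuthrich2014
  Literature.NumberTheory.EllipticCurves.ModularForms

set_option autoImplicit false

namespace Summit.BirchSwinnertonDyer.Rank1Residual.WAll

open Summit.BirchSwinnertonDyer
open Summit.BirchSwinnertonDyer.BirchSwinnertonDyer.Rank1Residual (NonCMAtTwo BSDpOnClassX9)
open Summit.BirchSwinnertonDyer.BirchSwinnertonDyer.Theorems.SchneiderWeaken (TypeBRankOneUnridered)

/-! ## §1 Rows 4, 5 and X2c from the X1 slices and the typed target `X2.Target` -/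

/-- **Rows 4, 5 and the X2c part of row 3 ⇐ the three X1 slices + `X2.Target`** (the rung-K5 leaf
`EisensteinPrimes = BSDpOnClassX1 ∧ X2.Target` split on its X1 side; cf.
`wallEisenstein_of_eisensteinPrimes`). [cite: Mazur1978, §6 Prop. 6.3 (1) (p. 153)] -/
theorem wallEisenstein_of_x1Slices_of_x2Target (hB : WAllCornerX1RankZeroBalanced)
    (hU : WAllCornerX1RankZeroUnbalanced) (hR1 : X1.RankOne.Statement) (hX2 : X2.Target) :
    WAllCornerX1 ∧ WAllCornerX2 ∧ WAllExclX2RankOne := by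
  obtain ⟨hA, hBB, hC⟩ := X2.targets_of_target hX2
  exact ⟨wAllCornerX1_of_x1Slices hB hU hR1, wallCornerX2_of_x2TargetsAB hA hBB,
    wallExclX2RankOne_of_x2TargetC hC⟩

/-! ## §2 The registry with row 4 at slice granularity -/

/-- **THE CLOSED LIST with row 4 by its three slices** (balanced rank-`0` · unbalanced rank-`0` ·
rank-`1` leaf statement), row 5 / X2c from `X2.Target`, rows 2 / 7 / 12i by prime × rank slices,
everything else as in `wAllExclusions_of_sliceLeaves`. [folklore] -/
theorem wAllExclusions_of_sliceLeaves_x1Slices (h5 : NonCMAtTwo)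
    (h30 : WAllExclAdditiveAtThreeRankZero) (h31 : WAllExclAdditiveAtThreeRankOne)
    (h50 : WAllExclAdditiveFiveLeRankZero) (h51 : WAllExclAdditiveFiveLeRankOne)
    (hK2a : X11b.MultiplicativeRankOne) (hK2b : X11b.MultiplicativeRankOneAtThree)
    (hX1B : WAllCornerX1RankZeroBalanced) (hX1U : WAllCornerX1RankZeroUnbalanced)
    (hX1R1 : X1.RankOne.Statement) (hX2 : X2.Target)
    (hK3 : Supersingular.SignedSupersingular)
    (h73 : WAllCornerX7AtThree) (h75 : WAllCornerX7FiveLe)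
    (hK6 : BSDpOnClassX9) (hX10b : X10.BSDpOnClassX10b) (hX11a : X11a.Target)
    (hF3 : WAllCornerFInertBadAtThree) (hF5 : WAllCornerFInertBadFiveLe)
    (hF2 : WAllCornerFTwo) (hFr : WAllCornerFRamified)
    (hW : sha_dvd_analyticSha) (hmod : hasEntireLFunction_rat)
    (hGZK : rank_eq_analyticRank_of_analyticRank_le_one) : WAllExclusions := by
  obtain ⟨hX1, hX2r, hX2c⟩ := wallEisenstein_of_x1Slices_of_x2Target hX1B hX1U hX1R1 hX2
  obtain ⟨hAdd, hX7, hFi⟩ := rows_of_primeSlices h30 h31 h50 h51 h73 h75 hF3 hF5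
  exact ⟨h5, hAdd, wAllExclMultRankOne_iff.mpr ⟨wallExclX11b_of_rungK2 hK2a hK2b, hX2c⟩, hX1, hX2r,
    wallCornerX6r0_of_signedSupersingular hK3 hW hGZK hmod, hX7,
    wallCornerX8_of_signedSupersingular hK3 hW hGZK hmod, wallCornerX9_of_bsdpOnClassX9 hmod hGZK hK6,
    wallCornerX10b_of_bsdpOnClassX10b hX10b, wallCornerX11a_of_x11aTarget hX11a,
    wAllCornerF_iff.mpr ⟨hF2, hFr, hFi⟩⟩

/-- **The same with row 4's rank-`1` slice read as its two parity cells**: the type-A cell (¬GVPar,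
the Keller–Yin Theorem A road: `X1.KellerYinTheoremAClass`) and LEAF I1
`SchneiderWeaken.TypeBRankOneUnridered` (`x1RankOneStatement_of_typeA_of_typeBLeaf`). [folklore] -/
theorem wAllExclusions_of_sliceLeaves_x1Cells (h5 : NonCMAtTwo)
    (h30 : WAllExclAdditiveAtThreeRankZero) (h31 : WAllExclAdditiveAtThreeRankOne)
    (h50 : WAllExclAdditiveFiveLeRankZero) (h51 : WAllExclAdditiveFiveLeRankOne)
    (hK2a : X11b.MultiplicativeRankOne) (hK2b : X11b.MultiplicativeRankOneAtThree)
    (hX1B : WAllCornerX1RankZeroBalanced) (hX1U : WAllCornerX1RankZeroUnbalanced)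
    (hX1A : ∀ (W : WeierstrassCurve ℚ) [W.IsElliptic] [W.IsGloballyMinimal] (p : ℕ) [Fact p.Prime],
      ClassX1 W p → ¬ GVPar W p → W.analyticRank = 1 → BSDp W p)
    (hI1 : TypeBRankOneUnridered) (hX2 : X2.Target)
    (hK3 : Supersingular.SignedSupersingular)
    (h73 : WAllCornerX7AtThree) (h75 : WAllCornerX7FiveLe)
    (hK6 : BSDpOnClassX9) (hX10b : X10.BSDpOnClassX10b) (hX11a : X11a.Target)
    (hF3 : WAllCornerFInertBadAtThree) (hF5 : WAllCornerFInertBadFiveLe)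
    (hF2 : WAllCornerFTwo) (hFr : WAllCornerFRamified)
    (hW : sha_dvd_analyticSha) (hmod : hasEntireLFunction_rat)
    (hGZK : rank_eq_analyticRank_of_analyticRank_le_one) : WAllExclusions :=
  wAllExclusions_of_sliceLeaves_x1Slices h5 h30 h31 h50 h51 hK2a hK2b hX1B hX1U
    (x1RankOneStatement_of_typeA_of_typeBLeaf hX1A hI1) hX2 hK3 h73 h75 hK6 hX10b hX11a hF3 hF5 hF2
    hFr hW hmod hGZK

/-- **W-ALL with row 4 at slice granularity, FIFTEEN named facts, the Gross–Zagier side primary**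
(`wAll_of_exclusions_primaryGZ ∘ wAllExclusions_of_sliceLeaves_x1Slices`; `hmod` derived, `hGZK` fed
from its road of record). [cite: Darmon2004, Thm. 3.22 and §3.9] -/
theorem wAll_of_sliceLeaves_x1Slices_primaryGZ (h5 : NonCMAtTwo)
    (h30 : WAllExclAdditiveAtThreeRankZero) (h31 : WAllExclAdditiveAtThreeRankOne)
    (h50 : WAllExclAdditiveFiveLeRankZero) (h51 : WAllExclAdditiveFiveLeRankOne)
    (hK2a : X11b.MultiplicativeRankOne) (hK2b : X11b.MultiplicativeRankOneAtThree)
    (hX1B : WAllCornerX1RankZeroBalanced) (hX1U : WAllCornerX1RankZeroUnbalanced)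
    (hX1R1 : X1.RankOne.Statement) (hX2 : X2.Target)
    (hK3 : Supersingular.SignedSupersingular)
    (h73 : WAllCornerX7AtThree) (h75 : WAllCornerX7FiveLe)
    (hK6 : BSDpOnClassX9) (hX10b : X10.BSDpOnClassX10b) (hX11a : X11a.Target)
    (hF3 : WAllCornerFInertBadAtThree) (hF5 : WAllCornerFInertBadFiveLe)
    (hF2 : WAllCornerFTwo) (hFr : WAllCornerFRamified)
    (hW : sha_dvd_analyticSha)
    (hSk : Skinner2016.thmC_padicValRat_bsd_rank_zero)
    (hBCS : BurungaleCastellaSkinner2025.cor131_padicValRat_bsd_rank_le_one)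
    (hJSW : JetchevSkinnerWan2017.thm121_padicValRat_bsd_rank_one)
    (hCGS : CastellaGrossiSkinner2025.thmD_padicValRat_bsd_rank_le_one)
    (hGV : GreenbergVatsal2000.thm13_charIdeal_eq_of_gvPar) (hGr : greenberg_charValue_rankZero)
    (hmodP : nonempty_modularParametrizationData)
    (hWa : waldspurger_exists_heegnerField_twist_ne_zero)
    (hMM : murtyMurty_exists_heegnerField_twist_simpleZero)
    (hGZ : ∀ (N : ℕ) [NeZero N] (W : WeierstrassCurve ℚ) (K : Type) [Field K] [NumberField K],
      gross_zagier N W K)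
    (hKo : ∀ (N : ℕ) [NeZero N] (W : WeierstrassCurve ℚ) (K : Type) [Field K] [NumberField K],
      kolyvagin N W K)
    (hCM : bsdTriple_of_hasCM_of_L_one_ne_zero) (hKob : Kobayashi2013.cor14_bsdp_of_cm_rank_one)
    (hYZ : YanZhu2026.thm415_padicValRat_bsd_rank_le_one)
    (hLLT : LiLiuTian2024.thm11_bsdp_of_cm_rank_one) : WAll :=
  wAll_of_exclusions_primaryGZ
    (wAllExclusions_of_sliceLeaves_x1Slices h5 h30 h31 h50 h51 hK2a hK2b hX1B hX1U hX1R1 hX2 hK3 h73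
      h75 hK6 hX10b hX11a hF3 hF5 hF2 hFr hW
      (X2.ClassClosureEntireFree.hasEntireLFunction_rat_of_nonempty_modularParametrizationData hmodP)
      (rank_eq_analyticRank_of_analyticRank_le_one_of_nonempty_modularParametrizationData hmodP hWa
        hMM hGZ hKo))
    hSk hBCS hJSW hCGS hGV hGr hmodP hWa hMM hGZ hKo hCM hKob hYZ hLLT

/-- **THE FULL BSD FORMULA FOR EVERY `E/ℚ` OF ANALYTIC RANK `≤ 1`** with row 4 at slice granularity:
FIFTEEN named facts and ONE sign binder `hL0`.
[cite: GrossZagier1986, Thm. V.(2.1) (p. 311) and V.§2 (pp. 312–313)]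
[cite: Darmon2004, Thm. 3.22 and §3.9] -/
theorem wAllFormula_of_sliceLeaves_x1Slices_primaryGZ (h5 : NonCMAtTwo)
    (h30 : WAllExclAdditiveAtThreeRankZero) (h31 : WAllExclAdditiveAtThreeRankOne)
    (h50 : WAllExclAdditiveFiveLeRankZero) (h51 : WAllExclAdditiveFiveLeRankOne)
    (hK2a : X11b.MultiplicativeRankOne) (hK2b : X11b.MultiplicativeRankOneAtThree)
    (hX1B : WAllCornerX1RankZeroBalanced) (hX1U : WAllCornerX1RankZeroUnbalanced)
    (hX1R1 : X1.RankOne.Statement) (hX2 : X2.Target)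
    (hK3 : Supersingular.SignedSupersingular)
    (h73 : WAllCornerX7AtThree) (h75 : WAllCornerX7FiveLe)
    (hK6 : BSDpOnClassX9) (hX10b : X10.BSDpOnClassX10b) (hX11a : X11a.Target)
    (hF3 : WAllCornerFInertBadAtThree) (hF5 : WAllCornerFInertBadFiveLe)
    (hF2 : WAllCornerFTwo) (hFr : WAllCornerFRamified)
    (hW : sha_dvd_analyticSha)
    (hSk : Skinner2016.thmC_padicValRat_bsd_rank_zero)
    (hBCS : BurungaleCastellaSkinner2025.cor131_padicValRat_bsd_rank_le_one)
    (hJSW : JetchevSkinnerWan2017.thm121_padicValRat_bsd_rank_one)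
    (hCGS : CastellaGrossiSkinner2025.thmD_padicValRat_bsd_rank_le_one)
    (hGV : GreenbergVatsal2000.thm13_charIdeal_eq_of_gvPar) (hGr : greenberg_charValue_rankZero)
    (hmodP : nonempty_modularParametrizationData)
    (hWa : waldspurger_exists_heegnerField_twist_ne_zero)
    (hMM : murtyMurty_exists_heegnerField_twist_simpleZero)
    (hGZ : ∀ (N : ℕ) [NeZero N] (W : WeierstrassCurve ℚ) (K : Type) [Field K] [NumberField K],
      gross_zagier N W K)
    (hKo : ∀ (N : ℕ) [NeZero N] (W : WeierstrassCurve ℚ) (K : Type) [Field K] [NumberField K],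
      kolyvagin N W K)
    (hCM : bsdTriple_of_hasCM_of_L_one_ne_zero) (hKob : Kobayashi2013.cor14_bsdp_of_cm_rank_one)
    (hYZ : YanZhu2026.thm415_padicValRat_bsd_rank_le_one)
    (hLLT : LiLiuTian2024.thm11_bsdp_of_cm_rank_one)
    (hL0 : re_entireLFunction_one_nonneg) : WAllFormula :=
  wAllFormula_of_wAll_oneSign hmodP hL0 hWa hGZ
    (wAll_of_sliceLeaves_x1Slices_primaryGZ h5 h30 h31 h50 h51 hK2a hK2b hX1B hX1U hX1R1 hX2 hK3 h73 h75
      hK6 hX10b hX11a hF3 hF5 hF2 hFr hW hSk hBCS hJSW hCGS hGV hGr hmodP hWa hMM hGZ hKo hCM hKob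
      hYZ hLLT)

end Summit.BirchSwinnertonDyer.Rank1Residual.WAll

end
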